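import Mathlib
import Literature.NumberTheory.GaloisRepresentations.RamificationFiltrationQuotients
import Literature.NumberTheory.GaloisRepresentations.TameInertiaGlobalCyclic
import Literature.NumberTheory.GaloisRepresentations.IntegralGaloisActionProofs
import Literature.NumberTheory.EllipticCurves.TateModuleUnipotentInertiaProofs
import HarnessLib

/-!
# Route `PhantomRMYoshida`, crux `StableYoshidaCongruence` (stmt-Langlands-13640), line
# `serre-dual-ribet-square`: Stub 2a `stub_steinbergMonodromy`, part 1 (tame inertia)

The ramification-theoretic half of Grothendieck's monodromy relation for the registered stub
`stub_steinbergMonodromy` (proved in the sibling file `…SteinbergMonodromy.lean`, which imports this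
one): **an arithmetic Frobenius acts on tame inertia through the `q_v`-th power.**

* `conj_smul_sub_smul_mul_mem_sq`, `conj_mul_pow_inv_mem_ramificationSubgroup_one` (finite level,
  any Dedekind domain `S` with a `G`-action, `Q` maximal with finite residue field): if `φ ∈ G`
  stabilises `Q` and acts by `x ↦ x^q` on `S/Q`, then `φ σ φ⁻¹ ≡ σ^q (mod G_1)` for every `σ` in the
  inertia group `G_0` — via the character `θ₀ : G_0/G_1 ↪ κ(Q)ˣ` of
  `exists_monoidHom_ramificationSubgroup_zero_units` and its independence of the uniformizer
  (Serre, *Local Fields*, IV §2 Prop. 7).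
* `conj_mul_pow_inv_mem_ramificationSubgroup_one_comap`: the same at the prime `𝔓 ∩ E` of a finite
  subextension `E/K` of `K̄` below a maximal ideal `𝔓` of `\bar ℤ_K`.
* `forall_absUpperRamificationSubgroup_apply_eq_one_of_pow_eq_one` (number fields): a continuous
  `f : Γ_K → H`, `H` discrete, whose values on `I_𝔓` have `p`-power order, `p ≠ char v`, kills every
  wild ramification group `Γ_K^u(𝔓)`, `u > 0` (`Γ_K^u ≤ I_𝔓` has `ℓ`-group image, `ℓ = char v`).
* `apply_conj_eq_pow_residueCard_of_isArithFrobAt` (number fields): for such a tame `f`, every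
  `τ ∈ I_𝔓` and every arithmetic Frobenius `φ` at `𝔓`, `f (φ τ φ⁻¹) = f(τ)^{q_v}` — finite level
  `E/K` (`exists_isGalois_ker_le`), `I_𝔓 ↠ G_0(𝔓 ∩ E)` (`inertia_comap_eq_map_absRestrictNormalHom`),
  `Γ_K^{φ(1)}(𝔓) ↠ G_1(𝔓 ∩ E)` (Herbrand, `absUpperRamificationSubgroup_map_absRestrictNormalHom_holds`).

Everything used is PROVED in the tree (`RamificationFiltrationQuotients`, `TameInertiaGlobalCyclic`,
`RamificationFiltrationProofs`, `TateModuleUnipotentInertiaProofs` §2); no definitions, no named facts.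

## References

* [SerreLocalFields1979] J.-P. Serre, *Local Fields*, GTM 67, Ch. IV §2 Prop. 7 and Cor. 1–3, §3
  Prop. 14 and Remark 1; Ch. I §7 Prop. 22, §8.
* [SerreTate1968] J.-P. Serre, J. Tate, *Good reduction of abelian varieties*, Ann. of Math. 88
  (1968), §1 and Appendix (structure of tame inertia, Frobenius action `x ↦ x^q`).
* [Marcus2018] D. A. Marcus, *Number Fields*, 2nd ed., Ch. 4, Ex. 19–21.
-/

-- `Summit.Langlands.Langlands.…` (summit = sub-problem name, D-0017 layout) trips `dupNamespace` on every decl.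
set_option linter.dupNamespace false

noncomputable section

open Ideal Literature.NumberTheory.GaloisRepresentations Field IsDedekindDomain
open scoped Pointwise NumberField

namespace Summit.Langlands.Langlands.Cruxes.StableYoshidaCongruence.SerreDualRibetSquare

/-! ### Finite level: Frobenius acts on `G_0/G_1` by the `q`-th power -/

section FiniteGroupLevel

variable {S : Type*} [CommRing S] [IsDedekindDomain S]
variable {G : Type*} [Group G] [MulSemiringAction G S]
variable {Q : Ideal S} [Q.IsMaximal]

/-- **`θ₀` does not depend on the uniformizer, conjugated form.**  Let `Q ≠ 0` be a maximal ideal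
of the Dedekind domain `S` with finite residue field, `π ∈ Q ∖ Q²`, `σ ∈ G_0 = I_Q` with
`σ π ≡ a π (mod Q²)` and `φ` in the decomposition group of `Q`.  Then
`(φ σ φ⁻¹) π ≡ φ(a) π (mod Q²)`: indeed `π' = φ⁻¹ π` is another uniformizer, `π' ≡ c π (mod Q²)`,
so `σ π' ≡ a π' (mod Q²)` as well, and applying `φ` gives the claim.
[cite: SerreLocalFields1979, Ch. IV §2 Prop. 7 (independence of `θ₀` from the uniformizer)] -/
theorem conj_smul_sub_smul_mul_mem_sq (hQ : Q ≠ ⊥) {π : S} (hπ : π ∈ Q) (hπ2 : π ∉ Q ^ 2)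
    {φ σ : G} (hφ : φ • Q = Q) (hσ : σ ∈ Q.ramificationSubgroup G 0) {a : S}
    (ha : σ • π - a * π ∈ Q ^ 2) :
    (φ * σ * φ⁻¹) • π - (φ • a) * π ∈ Q ^ 2 := by
  have hφ' : φ⁻¹ • Q = Q := by rw [inv_smul_eq_iff, hφ]
  -- the second uniformizer `π' = φ⁻¹ π ≡ c π (mod Q²)`
  set π' : S := φ⁻¹ • π with hπ'
  have hπ'Q : π' ∈ Q ^ 1 := by
    rw [pow_one]
    simpa [hφ'] using Ideal.smul_mem_pointwise_smul φ⁻¹ π Q hπ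
  obtain ⟨c, hc⟩ := exists_sub_mul_pow_mem_pow_succ hQ hπ hπ2 hπ'Q
  rw [pow_one] at hc
  -- `σ π' ≡ a π' (mod Q²)`
  have hσQ : ∀ x, σ • x - x ∈ Q := fun x => by simpa using hσ.2 x
  have hσπ : σ • π ∈ Q := by
    rw [show σ • π = (σ • π - π) + π by ring]
    exact Q.add_mem (hσQ π) hπ
  have hkey : σ • π' - a * π' ∈ Q ^ 2 := by
    have e : σ • π' - a * π' =
        (σ • (π' - c * π) - (π' - c * π)) + (σ • c - c) * (σ • π) + c * (σ • π - a * π) +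
          (1 - a) * (π' - c * π) := by
      rw [smul_sub, smul_mul']
      ring
    rw [e]
    refine Q ^ 2 |>.add_mem (Ideal.add_mem _ (Ideal.add_mem _ ?_ ?_) (Ideal.mul_mem_left _ _ ha))
      (Ideal.mul_mem_left _ _ hc)
    · exact smul_sub_mem_pow_of_mem_mul hσ (by simpa [pow_two] using hc)
    · rw [pow_two]
      exact Ideal.mul_mem_mul (hσQ c) hσπ
  -- apply `φ`
  have h2 : φ • (σ • π' - a * π') ∈ φ • Q ^ 2 := Ideal.smul_mem_pointwise_smul φ _ _ hkey
  rw [smul_pow', hφ, smul_sub, smul_mul', hπ', smul_inv_smul, ← mul_smul, ← mul_smul] at h2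
  exact h2

/-- **Frobenius acts on `G_0/G_1` by the `q`-th power** (finite level).  Let `Q ≠ 0` be a maximal
ideal of the Dedekind domain `S` with finite residue field, acted on by `G`; let `φ ∈ G` stabilise
`Q` and act as `x ↦ x^q` on `S/Q` (`φ x - x^q ∈ Q` for all `x`).  Then for every `σ` in the inertia
group `G_0 = I_Q`, `φ σ φ⁻¹ ≡ σ^q (mod G_1)`, i.e. `φ σ φ⁻¹ (σ^q)⁻¹ ∈ G_1`: with
`θ₀ : G_0 → κ(Q)ˣ`, `θ₀(σ) = σ(π)/π mod Q` (kernel `G_1`,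
`exists_monoidHom_ramificationSubgroup_zero_units`) one has `θ₀(φ σ φ⁻¹) = φ(θ₀ σ) = θ₀(σ)^q`
(`conj_smul_sub_smul_mul_mem_sq`).
[cite: SerreLocalFields1979, Ch. IV §2 Prop. 7 and Ex. / §3; Ch. I §8 (Frobenius on tame inertia)] -/
theorem conj_mul_pow_inv_mem_ramificationSubgroup_one [Finite (S ⧸ Q)] (hQ : Q ≠ ⊥)
    {φ : G} {q : ℕ} (hφQ : φ • Q = Q) (hφ : ∀ x : S, φ • x - x ^ q ∈ Q)
    {σ : G} (hσ : σ ∈ Q.inertia G) :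
    φ * σ * φ⁻¹ * (σ ^ q)⁻¹ ∈ Q.ramificationSubgroup G 1 := by
  classical
  -- a uniformizer and the character `θ₀ : G_0 → κ(Q)ˣ`
  obtain ⟨π, hπ, hπ2⟩ :=
    Ideal.exists_mem_pow_notMem_pow_succ Q hQ (Ideal.IsMaximal.ne_top inferInstance) 1
  rw [pow_one] at hπ
  obtain ⟨θ, hθ, hker⟩ := exists_monoidHom_ramificationSubgroup_zero_units (G := G) hQ hπ hπ2
  have hσ0 : σ ∈ Q.ramificationSubgroup G 0 := by rwa [Ideal.ramificationSubgroup_zero]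
  have hφD : φ ∈ Q.decompositionSubgroup G := Ideal.mem_decompositionSubgroup_iff.mpr hφQ
  have hconj0 : φ * σ * φ⁻¹ ∈ Q.ramificationSubgroup G 0 :=
    Ideal.ramificationSubgroup_conj_mem _ _ hσ0 hφD
  -- `σ π ≡ a π (mod Q²)`, so `θ₀ σ = ā` and `θ₀ (φ σ φ⁻¹) = φ(a) mod Q = ā ^ q`
  have hσπ : σ • π ∈ Q ^ 1 := by
    rw [pow_one, show σ • π = (σ • π - π) + π by ring]
    exact Q.add_mem (hσ π) hπ
  obtain ⟨a, ha⟩ := exists_sub_mul_pow_mem_pow_succ hQ hπ hπ2 hσπ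
  rw [pow_one] at ha
  have h1 : ((θ ⟨σ, hσ0⟩ : (S ⧸ Q)ˣ) : S ⧸ Q) = Ideal.Quotient.mk Q a := hθ ⟨σ, hσ0⟩ a ha
  have h2 : ((θ ⟨φ * σ * φ⁻¹, hconj0⟩ : (S ⧸ Q)ˣ) : S ⧸ Q) = Ideal.Quotient.mk Q (φ • a) :=
    hθ ⟨φ * σ * φ⁻¹, hconj0⟩ (φ • a) (conj_smul_sub_smul_mul_mem_sq hQ hπ hπ2 hφQ hσ0 ha)
  have h3 : Ideal.Quotient.mk Q (φ • a) = Ideal.Quotient.mk Q a ^ q := by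
    rw [← map_pow, Ideal.Quotient.mk_eq_mk_iff_sub_mem]
    exact hφ a
  have h4 : θ ⟨φ * σ * φ⁻¹, hconj0⟩ = θ (⟨σ, hσ0⟩ ^ q) := by
    ext
    rw [h2, h3, ← h1, map_pow, Units.val_pow_eq_pow_val]
  -- hence `φ σ φ⁻¹ (σ^q)⁻¹ ∈ ker θ₀ = G_1`
  have h5 : (⟨φ * σ * φ⁻¹, hconj0⟩ : Q.ramificationSubgroup G 0) * (⟨σ, hσ0⟩ ^ q)⁻¹ ∈ θ.ker := by
    rw [MonoidHom.mem_ker, map_mul, map_inv, h4, mul_inv_cancel]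
  rw [hker, Subgroup.mem_subgroupOf] at h5
  simpa using h5

end FiniteGroupLevel

/-! ### The prime `𝔓 ∩ E` of a finite subextension, and number fields -/

universe u

section FiniteLevel

variable {K : Type u} [Field K]

set_option synthInstance.maxHeartbeats 200000 in
/-- **Frobenius law on `G_0/G_1` at `𝔓 ∩ E`, generic coefficients.**  For `R` Dedekind with
fraction field `K`, a maximal ideal `𝔓` of `\bar ℤ_K = absIntegers R K` with `𝔓 ∩ R ≠ 0` and
`R/(𝔓 ∩ R)` finite, a finite separable subextension `E/K` of `K̄`, `φ ∈ Aut(E/K)` stabilising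
`𝔮 = 𝔓 ∩ E` and acting by `x ↦ x^q` on its residue field, and `σ` in the inertia group of `𝔮`:
`φ σ φ⁻¹ (σ^q)⁻¹ ∈ G_1(𝔮)` (`conj_mul_pow_inv_mem_ramificationSubgroup_one` for the Dedekind
domain `integralClosure R E`).  Stated for generic `R` so that the instance path of
`integralClosure R E` is the one of `integralClosureToAbsIntegers`.
[cite: SerreLocalFields1979, Ch. IV §2 Prop. 7 and Cor. 1; Ch. I §8] -/
theorem conj_mul_pow_inv_mem_ramificationSubgroup_one_comap (R : Type*) [CommRing R]
    [IsDedekindDomain R] [Algebra R K] [IsFractionRing R K] (𝔓 : Ideal (absIntegers R K))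
    [𝔓.IsMaximal] [Finite (R ⧸ 𝔓.under R)] (h0 : 𝔓.under R ≠ ⊥)
    (E : IntermediateField K (AlgebraicClosure K)) [FiniteDimensional K E]
    [Algebra.IsSeparable K E] {φ σ : E ≃ₐ[K] E} {q : ℕ}
    (hφQ : φ • 𝔓.comap (E.integralClosureToAbsIntegers R) =
      𝔓.comap (E.integralClosureToAbsIntegers R))
    (hφ : ∀ x, φ • x - x ^ q ∈ 𝔓.comap (E.integralClosureToAbsIntegers R))
    (hσ : σ ∈ (𝔓.comap (E.integralClosureToAbsIntegers R)).inertia (E ≃ₐ[K] E)) :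
    φ * σ * φ⁻¹ * (σ ^ q)⁻¹ ∈
      (𝔓.comap (E.integralClosureToAbsIntegers R)).ramificationSubgroup (E ≃ₐ[K] E) 1 := by
  -- adapted from `GaloisRep.exists_inertia_comap_eq_ramificationSubgroup_one_mul_zpowers`
  haveI : IsDedekindDomain (integralClosure R E) := integralClosure.isDedekindDomain R K E
  haveI := isMaximal_comap_integralClosureToAbsIntegers R 𝔓 E
  have hunder := under_comap_integralClosureToAbsIntegers R 𝔓 E
  -- finite residue ring of `𝔓 ∩ E`
  haveI : Finite (integralClosure R E ⧸ 𝔓.comap (E.integralClosureToAbsIntegers R)) := by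
    haveI : Module.Finite R (integralClosure R E) :=
      IsIntegralClosure.finite R K E (integralClosure R E)
    haveI : (𝔓.comap (E.integralClosureToAbsIntegers R)).LiesOver (𝔓.under R) := ⟨hunder.symm⟩
    haveI : Module.Finite (R ⧸ 𝔓.under R)
        (integralClosure R E ⧸ 𝔓.comap (E.integralClosureToAbsIntegers R)) :=
      module_finite_of_liesOver _ _
    exact Module.finite_of_finite (R ⧸ 𝔓.under R)
  refine conj_mul_pow_inv_mem_ramificationSubgroup_one ?_ hφQ hφ hσ
  intro h
  apply h0
  rw [← hunder, h]
  refine Ideal.comap_bot_of_injective _ fun x y hxy => ?_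
  have hxy' : algebraMap R E x = algebraMap R E y := by
    have := congrArg (fun z : integralClosure R E => (z : E)) hxy
    simpa only [Subalgebra.coe_algebraMap] using this
  rw [IsScalarTower.algebraMap_apply R K E, IsScalarTower.algebraMap_apply R K E] at hxy'
  exact IsFractionRing.injective R K ((algebraMap K E).injective hxy')

end FiniteLevel

section NumberField

variable {K : Type u} [Field K] [NumberField K]

/-- **From `p`-power orders on inertia to tameness.**  Let `f : Γ_K → H` be a continuous
homomorphism to a discrete group, `𝔓 ∣ v` a prime of `\bar ℤ_K`, and `p` a prime different from the
residue characteristic of `v` (`p ∉ v`).  If every `f τ`, `τ ∈ I_𝔓`, has `p`-power order, then `f`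
kills every wild ramification group `Γ_K^u(𝔓)`, `u > 0`: such a group lies in `I_𝔓`
(`absUpperRamificationSubgroup_le_inertia_holds`) and has `ℓ`-group image, `ℓ = char v`
(`Literature.NumberTheory.EllipticCurves.isPGroup_map_absUpperRamificationSubgroup`), and an element
of `ℓ`-power and `p`-power order is trivial.
[cite: SerreLocalFields1979, Ch. IV §2 Cor. 3 of Prop. 7 and §3 Remark 1] -/
theorem forall_absUpperRamificationSubgroup_apply_eq_one_of_pow_eq_one
    {v : HeightOneSpectrum (𝓞 K)} {𝔓 : Ideal (absIntegers (𝓞 K) K)} (h𝔓 : 𝔓 ∈ v.primesAbove)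
    {H : Type*} [Group H] [TopologicalSpace H] [DiscreteTopology H]
    (f : absoluteGaloisGroup K →ₜ* H) {p : ℕ} (hp : p.Prime) (hpv : (p : 𝓞 K) ∉ v.asIdeal)
    (hf : ∀ τ ∈ 𝔓.inertia (absoluteGaloisGroup K), ∃ m : ℕ, f τ ^ p ^ m = 1) :
    ∀ u : ℝ, 0 < u → ∀ σ ∈ absUpperRamificationSubgroup (𝓞 K) 𝔓 u, f σ = 1 := by
  intro u hu σ hσu
  have hσI : σ ∈ 𝔓.inertia (absoluteGaloisGroup K) :=
    absUpperRamificationSubgroup_le_inertia_holds (𝓞 K) 𝔓 u hσu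
  obtain ⟨m, hm⟩ := hf σ hσI
  set ℓ := ringChar (𝓞 K ⧸ v.asIdeal) with hℓ
  obtain ⟨t, ht⟩ :=
    Literature.NumberTheory.EllipticCurves.isPGroup_map_absUpperRamificationSubgroup f h𝔓 hu
      ⟨f σ, Subgroup.mem_map_of_mem f.toMonoidHom hσu⟩
  have ht' : f σ ^ ℓ ^ t = 1 := by
    have := congrArg Subtype.val ht
    rwa [Subgroup.coe_pow, Subgroup.coe_one] at this
  have hℓprime : ℓ.Prime := by
    haveI : Finite (𝓞 K ⧸ v.asIdeal) := Ideal.finiteQuotientOfFreeOfNeBot v.asIdeal v.ne_bot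
    exact CharP.char_is_prime (𝓞 K ⧸ v.asIdeal) ℓ
  have hpl : p ≠ ℓ := by
    intro hpl
    apply hpv
    rw [← Ideal.Quotient.eq_zero_iff_mem, map_natCast, hpl]
    exact ringChar.Nat.cast_ringChar
  have hcop : (p ^ m).Coprime (ℓ ^ t) :=
    Nat.Coprime.pow _ _ ((Nat.coprime_primes hp hℓprime).mpr hpl)
  exact Literature.NumberTheory.EllipticCurves.Monoid.eq_one_of_pow_eq_one_of_coprime hm ht' hcop

set_option synthInstance.maxHeartbeats 200000 in
/-- **Frobenius acts on tame inertia through the `q_v`-th power** (Serre–Tate / Grothendieck's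
description of `I_𝔓 / P_𝔓 ≅ ∏_{ℓ ≠ char v} ℤ_ℓ(1)`).  Let `f : Γ_K → H` be a continuous homomorphism to
a discrete group which is tamely ramified at the prime `𝔓 ∣ v` of `\bar ℤ_K` (it kills every
`Γ_K^u(𝔓)`, `u > 0`).  Then for every `τ ∈ I_𝔓` and every arithmetic Frobenius `φ` at `𝔓`
(`φ x ≡ x^{q_v} (mod 𝔓)`), `f (φ τ φ⁻¹) = f(τ)^{q_v}`.  Proof at finite level `E/K`
(`exists_isGalois_ker_le`): at `𝔮 = 𝔓 ∩ E`, `φ|_E` stabilises `𝔮` and is a `q_v`-Frobenius, `τ|_E`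
lies in `G_0(𝔮)` (`inertia_comap_eq_map_absRestrictNormalHom`), so
`φ τ φ⁻¹ τ^{-q_v}|_E ∈ G_1(𝔮)` (`conj_mul_pow_inv_mem_ramificationSubgroup_one_comap`), and
`G_1(𝔮) = Γ_K^{φ_𝔮(1)}(𝔓)|_E` (Herbrand, `absUpperRamificationSubgroup_map_absRestrictNormalHom_holds`)
is killed by `f`.
[cite: SerreTate1968, §1 and Appendix; SerreLocalFields1979, Ch. IV §2 Prop. 7, §3 Prop. 14] -/
theorem apply_conj_eq_pow_residueCard_of_isArithFrobAt
    {v : HeightOneSpectrum (𝓞 K)} {𝔓 : Ideal (absIntegers (𝓞 K) K)} (h𝔓 : 𝔓 ∈ v.primesAbove)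
    {H : Type*} [Group H] [TopologicalSpace H] [DiscreteTopology H]
    (f : absoluteGaloisGroup K →ₜ* H)
    (hf : ∀ u : ℝ, 0 < u → ∀ σ ∈ absUpperRamificationSubgroup (𝓞 K) 𝔓 u, f σ = 1)
    {τ : absoluteGaloisGroup K} (hτ : τ ∈ 𝔓.inertia (absoluteGaloisGroup K))
    {φ : absoluteGaloisGroup K} (hφ : IsArithFrobAt (𝓞 K) φ 𝔓) :
    f (φ * τ * φ⁻¹) = f τ ^ v.residueCard := by
  classical
  haveI : 𝔓.IsPrime := h𝔓.1
  haveI : 𝔓.IsMaximal := HeightOneSpectrum.isMaximal_of_mem_primesAbove h𝔓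
  -- `f` factors through a finite Galois `E/K`
  obtain ⟨E, hEfd, hEgal, hker⟩ := exists_isGalois_ker_le K f
  haveI := hEfd
  haveI := hEgal
  haveI : Algebra.IsSeparable K E := Algebra.IsSeparable.of_integral K E
  set res : absoluteGaloisGroup K →* (E ≃ₐ[K] E) := absRestrictNormalHom E with hres
  -- the prime `𝔮 = 𝔓 ∩ E`, its inertia group and `G_1(𝔮) = Γ_K^{φ(1)}(𝔓)|_E`
  set 𝔮 := 𝔓.comap (E.integralClosureToAbsIntegers (𝓞 K)) with h𝔮
  have hinertia : 𝔮.inertia (E ≃ₐ[K] E) = (𝔓.inertia (absoluteGaloisGroup K)).map res :=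
    inertia_comap_eq_map_absRestrictNormalHom 𝔓 E
  set u₀ : ℝ := herbrandPhi 𝔮 (E ≃ₐ[K] E) 1 with hu₀
  have hu₀pos : 0 < u₀ := herbrandPhi_pos 𝔮 (E ≃ₐ[K] E) one_pos
  have hG1 : 𝔮.ramificationSubgroup (E ≃ₐ[K] E) 1 =
      (absUpperRamificationSubgroup (𝓞 K) 𝔓 u₀).map res := by
    rw [absUpperRamificationSubgroup_map_absRestrictNormalHom_holds h𝔓 E u₀]
    change _ = 𝔮.ramificationSubgroup (E ≃ₐ[K] E) ⌈herbrandPsi 𝔮 (E ≃ₐ[K] E) u₀⌉₊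
    rw [hu₀, herbrandPsi_herbrandPhi_holds 𝔮 (E ≃ₐ[K] E) 1, Nat.ceil_one]
  haveI : Finite (𝓞 K ⧸ 𝔓.under (𝓞 K)) := by
    rw [← h𝔓.2.over]
    exact Ideal.finiteQuotientOfFreeOfNeBot v.asIdeal v.ne_bot
  have h0 : 𝔓.under (𝓞 K) ≠ ⊥ := by
    rw [← h𝔓.2.over]
    exact v.ne_bot
  -- `φ|_E` stabilises `𝔮` and is a `q_v`-Frobenius there
  have hφ𝔓 : φ • 𝔓 = 𝔓 := MulAction.mem_stabilizer_iff.mp hφ.mem_stabilizer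
  have hφQ : res φ • 𝔮 = 𝔮 := by
    rw [h𝔮, ← IntermediateField.comap_integralClosureToAbsIntegers_smul (𝓞 K) E φ 𝔓, hφ𝔓]
  have hφq : ∀ x, res φ • x - x ^ v.residueCard ∈ 𝔮 := by
    intro x
    rw [h𝔮, Ideal.mem_comap, map_sub, map_pow]
    change E.integralClosureToAbsIntegers (𝓞 K)
        (AlgEquiv.restrictNormalHom E (absoluteGaloisGroup.toAlgEquiv K φ) • x) -
      E.integralClosureToAbsIntegers (𝓞 K) x ^ v.residueCard ∈ 𝔓
    rw [E.integralClosureToAbsIntegers_restrictNormalHom_smul (𝓞 K) φ x]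
    exact (HeightOneSpectrum.isArithFrobAt_iff_of_mem_primesAbove h𝔓 φ).mp hφ _
  -- `τ|_E ∈ G_0(𝔮)`, so `(φ τ φ⁻¹ τ^{-q})|_E ∈ G_1(𝔮) = Γ_K^{u₀}(𝔓)|_E`
  have hτ' : res τ ∈ 𝔮.inertia (E ≃ₐ[K] E) := hinertia ▸ ⟨τ, hτ, rfl⟩
  have hmem := conj_mul_pow_inv_mem_ramificationSubgroup_one_comap (𝓞 K) 𝔓 h0 E hφQ hφq hτ'
  rw [← map_inv, ← map_mul, ← map_mul, ← map_pow, ← map_inv, ← map_mul, hG1] at hmem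
  obtain ⟨w, hw, hres_w⟩ := hmem
  -- `f` agrees on elements with the same restriction to `E`, and kills `w`
  have hfw : f w = 1 := hf u₀ hu₀pos w hw
  have hk : (φ * τ * φ⁻¹ * (τ ^ v.residueCard)⁻¹) * w⁻¹ ∈ f.toMonoidHom.ker := by
    apply hker
    rw [MonoidHom.mem_ker, map_mul, map_inv, hres_w, mul_inv_cancel]
  rw [MonoidHom.mem_ker] at hk
  change f (φ * τ * φ⁻¹ * (τ ^ v.residueCard)⁻¹ * w⁻¹) = 1 at hk
  rw [map_mul, map_inv, hfw, inv_one, mul_one, map_mul, map_inv, map_pow,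
    mul_inv_eq_one] at hk
  exact hk

end NumberField

/-- **Registered sub-goal `stub_steinbergMonodromyTame` of Stub 2a** (the statement through which this
helper file lands, `--supports stmt-Langlands-13640`; = `apply_conj_eq_pow_residueCard_of_isArithFrobAt`
in closed form): for a number field `K`, a prime `𝔓 ∣ v` of `\bar ℤ_K`, a continuous homomorphism
`f : Γ_K → H` to a discrete group killing every `Γ_K^u(𝔓)`, `u > 0`, every `τ ∈ I_𝔓` and every
arithmetic Frobenius `φ` at `𝔓`: `f (φ τ φ⁻¹) = f(τ)^{q_v}`.
[cite: SerreTate1968, §1 and Appendix; SerreLocalFields1979, Ch. IV §2 Prop. 7, §3 Prop. 14] -/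
theorem stub_steinbergMonodromyTame : ∀ (K : Type) [Field K] [NumberField K]
    (v : HeightOneSpectrum (NumberField.RingOfIntegers K))
    (𝔓 : Ideal (absIntegers (NumberField.RingOfIntegers K) K)), 𝔓 ∈ v.primesAbove →
    ∀ (H : Type) [Group H] [TopologicalSpace H] [DiscreteTopology H]
      (f : Field.absoluteGaloisGroup K →ₜ* H),
      (∀ u : ℝ, 0 < u → ∀ σ ∈ absUpperRamificationSubgroup (NumberField.RingOfIntegers K) 𝔓 u,
        f σ = 1) →
      ∀ τ ∈ 𝔓.inertia (Field.absoluteGaloisGroup K), ∀ φ : Field.absoluteGaloisGroup K,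
        IsArithFrobAt (NumberField.RingOfIntegers K) φ 𝔓 →
          f (φ * τ * φ⁻¹) = f τ ^ v.residueCard :=
  fun _ _ _ _ _ h𝔓 _ _ _ _ f hf _ hτ _ hφ =>
    apply_conj_eq_pow_residueCard_of_isArithFrobAt h𝔓 f hf hτ hφ


end Summit.Langlands.Langlands.Cruxes.StableYoshidaCongruence.SerreDualRibetSquare

end
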